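import Literature.AlgebraicGeometry.Resolution.QuasiRegularSequences
import Mathlib.RingTheory.LocalProperties.Basic
import Mathlib.RingTheory.Localization.AtPrime.Basic
import HarnessLib

/-!
# Quasi-regularity is local: it can be checked in the localisations at the maximal ideals

Route `ResolutionOfSingularities/WeightedInvariant`, door crux `HypersurfaceCentreConstruction`
(stmt-ResolutionOfSingularities-19897) — OURS, helper; e-ladder plan of `res-L1-w43-stub-10`, sub-lemma L0-η of
`stub_e1_centre` (cell res-hironaka, `D/res-D-pv-025/DOOR-ELADDER-PLAN.md` §7): to apply the primary-ness of
weighted-chart pieces (`isPrimary_span_weightedMonomials`, which needs `IsQuasiRegular u` in the RING of sections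
`Γ(Y, U)`) one must pass from the stalks — where the chart parameters are part of a regular system of parameters,
hence quasi-regular (`isQuasiRegular_of_linearIndependent_toCotangent`) — to the ring of sections.  This file
proves the local-to-global principle for Matsumura's quasi-regularity (tree `IsQuasiRegular`):

* `IsQuasiRegular.map_of_ringEquiv` — quasi-regularity is transported along ring isomorphisms;
* `coeff_mem_map_of_isQuasiRegular_localization` — the coefficientwise reading of quasi-regularity in one
  localisation `R_P`, downstairs;
* `isQuasiRegular_of_localization_maximal` — **if `x` is quasi-regular in `R_𝔪` for every maximal ideal
  `𝔪 ⊇ (x)`, then `x` is quasi-regular in `R`** (membership of the coefficients in `(x)` is checked locally,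
  `Ideal.mem_of_localization_maximal`; at maximal ideals not containing `(x)` the extended ideal is the unit
  ideal); `isQuasiRegular_of_isLocalization_maximal` — the same with arbitrary localisations `S 𝔪`
  (e.g. the stalks of a scheme at the closed points of an affine chart).

Pure commutative algebra; no named facts. [cite: Matsumura1987, §16]
-/

noncomputable section

set_option linter.dupNamespace false -- mandated namespace of this single-conjunct summit

namespace Summit.ResolutionOfSingularities.ResolutionOfSingularities.Theorems

universe u v

open MvPolynomial Literature.AlgebraicGeometry.Resolution

variable {R : Type u} [CommRing R] {ι : Type v}

/-- Evaluating after a ring map: `φ (F(x)) = (φF)(φ ∘ x)`. [folklore] -/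
theorem ringHom_eval_eq_eval_map {S : Type*} [CommRing S] (φ : R →+* S) (x : ι → R) (F : MvPolynomial ι R) :
    φ (eval x F) = eval (φ ∘ x) (MvPolynomial.map φ F) := by
  induction F using MvPolynomial.induction_on with
  | C a => simp
  | add p q hp hq => simp only [map_add, hp, hq]
  | mul_X p i hp => simp only [map_mul, hp, map_X, eval_X, Function.comp_apply]

/-- The ideal of a mapped family is the extension of the ideal of the family. [folklore] -/
theorem span_range_comp_eq_map {S : Type*} [CommRing S] (φ : R →+* S) (x : ι → R) :
    Ideal.span (Set.range (φ ∘ x)) = (Ideal.span (Set.range x)).map φ := by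
  rw [Ideal.map_span, Set.range_comp]

/-- **Quasi-regularity is transported along ring isomorphisms.** [folklore] -/
theorem IsQuasiRegular.map_of_ringEquiv {S : Type*} [CommRing S] (e : R ≃+* S) {x : ι → R}
    (hx : IsQuasiRegular x) : IsQuasiRegular (e ∘ x) := by
  rw [isQuasiRegular_def]
  intro n F hF hFe m
  -- pull `F` back along `e`
  set G := MvPolynomial.map (e.symm : S →+* R) F with hG
  have hG_hom : G.IsHomogeneous n := hF.map _
  have hGF : MvPolynomial.map (e : R →+* S) G = F := by
    rw [hG, MvPolynomial.map_map]
    have : (e : R →+* S).comp (e.symm : S →+* R) = RingHom.id S := by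
      ext s; simp
    rw [this, MvPolynomial.map_id]
  have hx' : (e : R →+* S) ∘ x = e ∘ x := rfl
  -- `G(x) ∈ (x)^{n+1}` because `e (G(x)) = F(e x)`
  have hGe : eval x G ∈ Ideal.span (Set.range x) ^ (n + 1) := by
    have h1 : (e : R →+* S) (eval x G) = eval (e ∘ x) F := by
      rw [ringHom_eval_eq_eval_map, hGF]; rfl
    have h2 : eval (e ∘ x) F ∈ (Ideal.span (Set.range x) ^ (n + 1)).map (e : R →+* S) := by
      rw [Ideal.map_pow, ← span_range_comp_eq_map]; exact hFe
    rw [← h1] at h2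
    have := Ideal.mem_comap.mpr h2
    rwa [Ideal.comap_map_of_bijective (e : R →+* S) e.bijective] at this
  have hcoeff := (isQuasiRegular_def x).mp hx n G hG_hom hGe m
  -- coefficients of `F` are the images of those of `G`
  have hcF : F.coeff m = e (G.coeff m) := by
    rw [← hGF, coeff_map]; rfl
  rw [hcF]
  have hs : Ideal.span (Set.range (⇑e ∘ x)) = (Ideal.span (Set.range x)).map (e : R →+* S) := by
    rw [Ideal.map_span, Set.range_comp]
    rfl
  rw [hs]
  exact Ideal.mem_map_of_mem _ hcoeff

/-- **Quasi-regularity in a localisation at a prime containing `(x)`, read coefficientwise downstairs**: if `x`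
is quasi-regular in `R_P` then for a form `F` of degree `n` over `R` with `F(x) ∈ (x)^{n+1}` the images of the
coefficients of `F` lie in `(x) R_P`. [folklore] -/
theorem coeff_mem_map_of_isQuasiRegular_localization (x : ι → R) (P : Ideal R) [P.IsPrime] (S : Type*)
    [CommRing S] [Algebra R S] [IsLocalization.AtPrime S P]
    (hx : IsQuasiRegular (algebraMap R S ∘ x)) {n : ℕ} {F : MvPolynomial ι R} (hF : F.IsHomogeneous n)
    (hFe : eval x F ∈ Ideal.span (Set.range x) ^ (n + 1)) (m : ι →₀ ℕ) :
    algebraMap R S (F.coeff m) ∈ (Ideal.span (Set.range x)).map (algebraMap R S) := by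
  have hF' : (MvPolynomial.map (algebraMap R S) F).IsHomogeneous n := hF.map _
  have hFe' : eval (algebraMap R S ∘ x) (MvPolynomial.map (algebraMap R S) F) ∈
      Ideal.span (Set.range (algebraMap R S ∘ x)) ^ (n + 1) := by
    rw [← ringHom_eval_eq_eval_map, span_range_comp_eq_map, ← Ideal.map_pow]
    exact Ideal.mem_map_of_mem _ hFe
  have h := (isQuasiRegular_def _).mp hx n _ hF' hFe' m
  rwa [coeff_map, span_range_comp_eq_map] at h

/-- **Quasi-regularity is local.**  If for every MAXIMAL ideal `𝔪` containing `(x)` the family `x` is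
quasi-regular in the localisation `R_𝔪`, then `x` is quasi-regular in `R`: the coefficients of a form `F` of
degree `n` with `F(x) ∈ (x)^{n+1}` lie in `(x) R_𝔪` for every maximal `𝔪` (by the hypothesis if `(x) ⊆ 𝔪`, and
because `(x) R_𝔪 = R_𝔪` otherwise), hence in `(x)` (`Ideal.mem_of_localization_maximal`). [cite: Matsumura1987, §16] -/
theorem isQuasiRegular_of_localization_maximal (x : ι → R)
    (h : ∀ (P : Ideal R) [P.IsMaximal], Ideal.span (Set.range x) ≤ P →
      IsQuasiRegular (algebraMap R (Localization.AtPrime P) ∘ x)) :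
    IsQuasiRegular x := by
  rw [isQuasiRegular_def]
  intro n F hF hFe m
  refine Ideal.mem_of_localization_maximal fun P hP => ?_
  by_cases hle : Ideal.span (Set.range x) ≤ P
  · exact coeff_mem_map_of_isQuasiRegular_localization x P (Localization.AtPrime P) (h P hle) hF hFe m
  · rw [IsLocalization.AtPrime.map_eq_top_of_not_le _ hle]
    exact Submodule.mem_top

/-- **Quasi-regularity is local, with arbitrary localisations**: the same with any `R`-algebras `S 𝔪` that are
localisations at the maximal ideals `𝔪 ⊇ (x)` (e.g. the stalks of a scheme at the closed points of an affine
chart). [folklore] -/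
theorem isQuasiRegular_of_isLocalization_maximal (x : ι → R)
    (S : ∀ (P : Ideal R) [P.IsMaximal], Type u) (_ : ∀ (P : Ideal R) [P.IsMaximal], CommRing (S P))
    (_ : ∀ (P : Ideal R) [P.IsMaximal], Algebra R (S P))
    (_ : ∀ (P : Ideal R) [P.IsMaximal], IsLocalization.AtPrime (S P) P)
    (h : ∀ (P : Ideal R) [P.IsMaximal], Ideal.span (Set.range x) ≤ P →
      IsQuasiRegular (algebraMap R (S P) ∘ x)) :
    IsQuasiRegular x := by
  rw [isQuasiRegular_def]
  intro n F hF hFe m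
  refine Ideal.mem_of_localization_maximal fun P hP => ?_
  by_cases hle : Ideal.span (Set.range x) ≤ P
  · -- transport from `S P` to `Localization.AtPrime P`
    have hmem := coeff_mem_map_of_isQuasiRegular_localization x P (S P) (h P hle) hF hFe m
    let e : S P ≃ₐ[R] Localization.AtPrime P :=
      IsLocalization.algEquiv P.primeCompl (S P) (Localization.AtPrime P)
    have hφ : (e : S P →+* Localization.AtPrime P).comp (algebraMap R (S P)) =
        algebraMap R (Localization.AtPrime P) := e.toAlgHom.comp_algebraMap
    have := Ideal.mem_map_of_mem (e : S P →+* Localization.AtPrime P) hmem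
    rw [Ideal.map_map, hφ] at this
    rwa [← RingHom.comp_apply, hφ] at this
  · rw [IsLocalization.AtPrime.map_eq_top_of_not_le _ hle]
    exact Submodule.mem_top

end Summit.ResolutionOfSingularities.ResolutionOfSingularities.Theorems

end
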